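import Mathlib.Analysis.Calculus.ContDiff.WithLp
import Literature.Geometry.Lorentzian.FinalState
import Literature.Geometry.Lorentzian.InitialDataHomothety
import Literature.Geometry.Lorentzian.Genericity
import Summits.FinalStateConjecture.FinalStateConjecture.Theorems.PhaseMixingCaptureCaptureSufficesDilatedEnd
import HarnessLib

/-!
# Stub `stub_dilationThread` of the line `capture-exports-censorship-diagonal-surgery`
# (crux `CaptureSuffices`, stmt-FinalStateConjecture-9953, route `PhaseMixingCapture`)

Through every datum `d` of Christodoulou's admissible class `𝓓 = admissibleVacuumData X`
(`Literature/Geometry/Lorentzian/FinalState.lean`: vacuum constraints, completeness, one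
strongly asymptotically flat end) passes a THREAD: a smooth injective admissible `1`-parameter
family of data `F` with `F 0 = d`, all of whose members are positive dilates
`(λ² h, λ k)` of `d = (h, k)`. The thread is the **homothety family**
`F c := d.homothety (exp c₀) = (e^{2c₀} h, e^{c₀} k)`, `λ = e^{c₀}`
(`Literature/Geometry/Lorentzian/InitialDataHomothety.lean`).

* `isComplete_homothety_iff` — `(X, λ² h)` is complete iff `(X, h)` is (the Levi-Civita
  connection, hence the geodesics, of `λ² h` are those of `h`: `leviCivita_constSmul`);
* `homothety_mem_admissibleVacuumData` — **the admissible class is invariant under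
  homotheties**: the constraints are scale covariant (`isVacuumConstraintSolution_homothety_iff`),
  completeness is unchanged, and the sole strongly asymptotically flat end of `d` dilates to a
  sole strongly asymptotically flat end of the homothety with mass parameter `λ M`
  (`exists_afEnd_of_isDilate`, helper module
  `…Theorems.PhaseMixingCaptureCaptureSufficesDilatedEnd`);
* `homothety_injective` — `λ ↦ d.homothety λ` is injective (`h` is Riemannian and `X ≠ ∅`);
* `contMDiffAt_smul_totalSpace`, `isSmoothDataFamily_homothety` — **homothety families with a
  smooth positive factor `f : ℝᵐ → ℝ` are jointly smooth** (`IsSmoothDataFamily`): the maps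
  `(c, x) ↦ (x, f(c)² hₓ)`, `(c, x) ↦ (x, f(c) kₓ)` into the bundle of bilinear forms on `TX`
  are `C^∞` on `ℝᵐ × X` — Mathlib's `Bundle.contMDiffAt_totalSpace` plus the fibrewise
  linearity of the trivializations (as in Mathlib's `ContMDiffWithinAt.smul_section`, the
  special case of a section); `isSmoothDataFamily_homothety_exp` is the exponential thread;
* `stub_dilationThread` — the registered stub, assembled from these.
-/

-- the doubled `FinalStateConjecture.FinalStateConjecture` path component trips dupNamespace
set_option linter.dupNamespace false

noncomputable section

namespace Summit.FinalStateConjecture.FinalStateConjecture.Theorems.CaptureSuffices.CaptureExportsCensorshipDiagonalSurgery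

open Set Filter Function Topology
open scoped Manifold ContDiff Topology
open Literature.Geometry.Lorentzian

variable {X : Type} [TopologicalSpace X] [ChartedSpace E3 X] [IsManifold (𝓡 3) ∞ X]

/-! ### Homotheties preserve the admissible class -/

/-- Homotheties with equal factors are equal (the positivity proofs are irrelevant). [folklore] -/
theorem homothety_congr (d : InitialDataSet (𝓡 3) X) {a b : ℝ} (ha : 0 < a) (hb : 0 < b)
    (h : a = b) : d.homothety a ha = d.homothety b hb := by
  subst h
  rfl

/-- **Completeness is invariant under homotheties**: `(X, λ² h)` is (geodesically) complete iff
`(X, h)` is, since the Levi-Civita connection of `λ² h` is that of `h`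
(`PseudoRiemannianMetric.leviCivita_constSmul`), so both have the same geodesics.
O'Neill 1983, Ch. 3, p. 68; Topping 2006, §1.2.3. [folklore] -/
theorem isComplete_homothety_iff (d : InitialDataSet (𝓡 3) X) {c : ℝ} (hc : 0 < c)
    [d.metric.HasLeviCivita] [(d.homothety c hc).metric.HasLeviCivita] :
    (d.homothety c hc).IsComplete ↔ d.IsComplete := by
  haveI := d.hasLeviCivita_constSmul_of_homothety hc
  have key : ∀ (g' : PseudoRiemannianMetric (𝓡 3) ∞ E3 (TangentSpace (𝓡 3) : X → Type _))
      [g'.HasLeviCivita], g' = d.metric.constSmul (c ^ 2) (pow_pos hc 2).ne' →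
      (IsGeodesicallyComplete g'.leviCivita ↔ IsGeodesicallyComplete d.metric.leviCivita) := by
    intro g' _ hg'
    subst hg'
    rw [PseudoRiemannianMetric.leviCivita_constSmul]
  exact key _ (d.homothety_metric hc)

/-- **Christodoulou's admissible class is invariant under homotheties** `(h, k) ↦ (λ² h, λ k)`,
`λ > 0`: the vacuum constraints are scale covariant (Bartnik–Isenberg 2004, §2;
`isVacuumConstraintSolution_homothety_iff`), completeness is unchanged
(`isComplete_homothety_iff`; the standing Levi-Civita hypothesis of `d` is supplied by
`PseudoRiemannianMetric.hasLeviCivita`), and the sole, Dafermos–Rodnianski asymptotically flat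
end of `d` (mass parameter `M`) becomes, after dilating its chart by `λ`, a sole
Dafermos–Rodnianski asymptotically flat end of the homothety with mass parameter `λ M`
(`exists_afEnd_of_isDilate`). Christodoulou, CQG 16 (1999), p. A24. [folklore] -/
theorem homothety_mem_admissibleVacuumData {d : InitialDataSet (𝓡 3) X}
    (hd : d ∈ admissibleVacuumData X) {c : ℝ} (hc : 0 < c) :
    d.homothety c hc ∈ admissibleVacuumData X := by
  obtain ⟨hlc, e, M, hsole, hSAF⟩ := hd
  refine ⟨?_, ?_⟩
  · intro _
    haveI := d.metric.hasLeviCivita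
    obtain ⟨h1, h2⟩ := hlc
    exact ⟨(d.isVacuumConstraintSolution_homothety_iff hc).2 h1,
      (isComplete_homothety_iff d hc).2 h2⟩
  · obtain ⟨e', hsole', hSAF'⟩ := exists_afEnd_of_isDilate X e d (d.homothety c hc) c M hc
      (fun x v w ↦ d.homothety_h_inner hc x v w) (fun x v w ↦ d.homothety_k hc x v w) hsole hSAF
    exact ⟨e', c * M, hsole', hSAF'⟩

/-- **The homothety factor is determined by the homothety** (on a nonempty manifold): if
`d.homothety a = d.homothety b` then `a = b`, because `a² h(v, v) = b² h(v, v)` for a nonzero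
tangent vector `v`, and `h(v, v) > 0`. [folklore] -/
theorem homothety_injective [Nonempty X] (d : InitialDataSet (𝓡 3) X) {a b : ℝ} (ha : 0 < a)
    (hb : 0 < b) (h : d.homothety a ha = d.homothety b hb) : a = b := by
  obtain ⟨x⟩ := (inferInstance : Nonempty X)
  have hv0 : (EuclideanSpace.single (0 : Fin 3) (1 : ℝ) : E3) ≠ 0 := by
    rw [Ne, PiLp.single_eq_zero_iff]
    exact one_ne_zero
  set v : TangentSpace (𝓡 3) x := (EuclideanSpace.single (0 : Fin 3) (1 : ℝ) : E3) with hv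
  have hpos : 0 < d.h.inner x v v := d.h.pos x v hv0
  have h1 : (d.homothety a ha).h.inner x v v = (d.homothety b hb).h.inner x v v := by rw [h]
  rw [InitialDataSet.homothety_h_inner, InitialDataSet.homothety_h_inner] at h1
  have h2 : a ^ 2 = b ^ 2 := mul_right_cancel₀ hpos.ne' h1
  nlinarith [sq_nonneg (a - b), sq_nonneg (a + b)]

/-! ### Joint smoothness of homothety families -/

section General

open Bundle

variable {EB : Type*} [NormedAddCommGroup EB] [NormedSpace ℝ EB] {HB : Type*} [TopologicalSpace HB]
  {IB : ModelWithCorners ℝ EB HB} {B : Type*} [TopologicalSpace B] [ChartedSpace HB B]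
  {F : Type*} [NormedAddCommGroup F] [NormedSpace ℝ F]
  {V : B → Type*} [TopologicalSpace (TotalSpace F V)] [∀ b, TopologicalSpace (V b)]
  [∀ b, AddCommGroup (V b)] [∀ b, Module ℝ (V b)] [FiberBundle F V] [VectorBundle ℝ F V]
  {EN : Type*} [NormedAddCommGroup EN] [NormedSpace ℝ EN] {HN : Type*} [TopologicalSpace HN]
  {J : ModelWithCorners ℝ EN HN} {N : Type*} [TopologicalSpace N] [ChartedSpace HN N]
  {n : ℕ∞ω}

/-- **Scaling the fibre component of a `Cⁿ` map into a vector bundle by a `Cⁿ` real function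
gives a `Cⁿ` map**: if `T : N → TotalSpace F V` and `φ : N → ℝ` are `Cⁿ` at `q₀` then so is
`q ↦ (π (T q), φ(q) • (T q)₂)`. Read in the trivialization at `π (T q₀)` the fibre coordinate of
the new map is `φ(q) •` that of `T`, by fibrewise linearity (`Trivialization.linear`), near `q₀`
(Mathlib, `Bundle.contMDiffAt_totalSpace`; the section case is Mathlib's
`ContMDiffAt.smul_section`). [folklore] -/
theorem contMDiffAt_smul_totalSpace {T : N → TotalSpace F V} {φ : N → ℝ} {q₀ : N}
    (hT : ContMDiffAt J (IB.prod 𝓘(ℝ, F)) n T q₀) (hφ : ContMDiffAt J 𝓘(ℝ, ℝ) n φ q₀) :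
    ContMDiffAt J (IB.prod 𝓘(ℝ, F)) n
      (fun q ↦ TotalSpace.mk' F (T q).proj (φ q • (T q).2)) q₀ := by
  rw [contMDiffAt_totalSpace] at hT ⊢
  obtain ⟨hproj, hfib⟩ := hT
  refine ⟨hproj, ?_⟩
  set e := trivializationAt F V (T q₀).proj with he
  have hbase : ∀ᶠ q in 𝓝 q₀, (T q).proj ∈ e.baseSet :=
    hproj.continuousAt.preimage_mem_nhds
      (e.open_baseSet.mem_nhds (FiberBundle.mem_baseSet_trivializationAt' (T q₀).proj))
  refine (hφ.smul hfib).congr_of_eventuallyEq ?_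
  filter_upwards [hbase] with q hq
  exact (e.linear ℝ hq).map_smul (φ q) (T q).2

end General

/-- **Homothety families are jointly smooth**: for a smooth positive `f : ℝᵐ → ℝ` the family
`c ↦ (f(c)² h, f(c) k)` of homotheties of `d = (h, k)` is a smooth `m`-parameter family of
initial data (`IsSmoothDataFamily`): `(c, x) ↦ (x, f(c)² hₓ)` is the `C^∞` map
`(c, x) ↦ (x, hₓ)` (smoothness of the section `h` composed with the projection `ℝᵐ × X → X`)
with fibre component scaled by the `C^∞` function `(c, x) ↦ f(c)²`, and likewise for `k`.
[folklore] -/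
theorem isSmoothDataFamily_homothety (d : InitialDataSet (𝓡 3) X) {m : ℕ}
    (f : EuclideanSpace ℝ (Fin m) → ℝ) (hf : ContDiff ℝ ∞ f) (hpos : ∀ c, 0 < f c) :
    InitialDataSet.IsSmoothDataFamily m (fun c ↦ d.homothety (f c) (hpos c)) := by
  have hf' : ContMDiff (𝓘(ℝ, EuclideanSpace ℝ (Fin m)).prod (𝓡 3)) 𝓘(ℝ, ℝ) ∞
      (fun p : EuclideanSpace ℝ (Fin m) × X ↦ f p.1) :=
    hf.contMDiff.comp contMDiff_fst
  refine ⟨fun p ↦ ?_, fun p ↦ ?_⟩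
  · exact contMDiffAt_smul_totalSpace ((d.h.contMDiff.comp contMDiff_snd) p) ((hf'.pow 2) p)
  · exact contMDiffAt_smul_totalSpace ((d.contMDiff_k.comp contMDiff_snd) p) (hf' p)

/-- **The exponential homothety family `c ↦ (e^{2c} h, e^{c} k)` through `d = (h, k)` is a
smooth `1`-parameter family of initial data** (the dilation thread of the line). [folklore] -/
theorem isSmoothDataFamily_homothety_exp (d : InitialDataSet (𝓡 3) X) :
    InitialDataSet.IsSmoothDataFamily 1
      (fun c : EuclideanSpace ℝ (Fin 1) ↦ d.homothety (Real.exp (c 0)) (Real.exp_pos _)) :=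
  isSmoothDataFamily_homothety d (fun c ↦ Real.exp (c 0))
    (Real.contDiff_exp.comp (contDiff_piLp_apply (p := 2))) _

/-! ### The registered stub -/

/-- **STUB `stub_dilationThread` (the dilation thread).** Through every admissible datum `d`
passes a smooth injective admissible `1`-parameter family all of whose members are positive
dilates of `d`: the homothety family `F c = (e^{2c₀} h, e^{c₀} k)`, `λ = e^{c₀}` — jointly
smooth (`isSmoothDataFamily_homothety_exp`), `F 0 = d` (`homothety_one`), injective
(`homothety_injective` and injectivity of `exp`), admissible
(`homothety_mem_admissibleVacuumData`), and a `λ`-dilate by construction. [folklore] -/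
theorem stub_dilationThread :
    ∀ (X : Type) [TopologicalSpace X] [ChartedSpace E3 X] [IsManifold (𝓡 3) ∞ X] [T2Space X]
      [SecondCountableTopology X] [ConnectedSpace X],
      ∀ d ∈ admissibleVacuumData X,
        ∃ F : EuclideanSpace ℝ (Fin 1) → InitialDataSet (𝓡 3) X,
          InitialDataSet.IsSmoothDataFamily 1 F ∧ F 0 = d ∧ Function.Injective F ∧
            (∀ c, F c ∈ admissibleVacuumData X) ∧
              ∀ c, ∃ lam : ℝ, 0 < lam ∧
                (∀ (x : X) (v w : TangentSpace (𝓡 3) x),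
                    (F c).h.inner x v w = lam ^ 2 * d.h.inner x v w) ∧
                  ∀ (x : X) (v w : TangentSpace (𝓡 3) x), (F c).k x v w = lam * d.k x v w := by
  intro X _ _ _ _ _ _ d hd
  refine ⟨fun c ↦ d.homothety (Real.exp (c 0)) (Real.exp_pos _), isSmoothDataFamily_homothety_exp d,
    ?_, ?_, fun c ↦ homothety_mem_admissibleVacuumData hd (Real.exp_pos _), fun c ↦
      ⟨Real.exp (c 0), Real.exp_pos _, fun _ _ _ ↦ rfl, fun _ _ _ ↦ rfl⟩⟩
  · -- `F 0 = d`
    show d.homothety (Real.exp ((0 : EuclideanSpace ℝ (Fin 1)) 0)) (Real.exp_pos _) = d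
    rw [homothety_congr d (Real.exp_pos _) one_pos (by simp), InitialDataSet.homothety_one]
  · -- injectivity
    intro a b hab
    have h1 : Real.exp (a 0) = Real.exp (b 0) :=
      homothety_injective d (Real.exp_pos _) (Real.exp_pos _) hab
    have h2 : a 0 = b 0 := Real.exp_injective h1
    ext i
    fin_cases i
    exact h2

end Summit.FinalStateConjecture.FinalStateConjecture.Theorems.CaptureSuffices.CaptureExportsCensorshipDiagonalSurgery

end
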